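import Mathlib
import Literature.Analysis.FluidPDE.Tao2016AveragedNS.BoundedEternalSolutions
import Summits.NavierStokesRegularity.NavierStokesRegularity.Theorems.TaoLadderRungTwoBreakNoSurvivingEternalViscBddOneUpwardFluxThroughput
import HarnessLib

/-!
# The UPWARD-FLUX THROUGHPUT RECURSION WITH COVARIANT VISCOSITY (any `ν̂ ≥ 0`) — helper toward K1ᵛ(1)
# `TaoLadderRungTwoBreak.NoSurvivingEternalViscBddOne` (stmt-NavierStokesRegularity-20419), both split children (ρ0)/(ρ+)

MODEL lattice ODEs only (Tao 2016 §4, §6.4; cell vocabulary `IsEternalVisc`, `UniformBound`, `physEnergy`, `physFlux`, `viscCoef`);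
nothing here is a statement about the Navier–Stokes equations; no summit, crux or rung LEAF is proved
(`--supports stmt-NavierStokesRegularity-20419`).  Sequel to `…UpwardFluxThroughput` (the inviscid recursion, exact far-past
identity).  With covariant viscosity the shell identity reads `E_{k+1}' = F_k − F_{k+1} − 2·visc_{k+1}·E_{k+1}`; the right object is the
**held energy** of shell `k+1`,

  `G_{k+1}(σ) := ∫_{-∞}^{σ}F_k − ∫_{-∞}^{σ}F_{k+1}`  ( = energy present + energy already dissipated in shell `k+1`),

which dominates `E_{k+1}` (`physEnergy_le_heldEnergy`), has derivative `F_k − F_{k+1}` (`hasDerivAt_integral_Iic`), and — when the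
incoming flux `F_k` is non-negative — obeys the same **no-backscatter retention** as the inviscid energy
(`heldEnergy_ge_retention`: `G(σ) ≥ exp(−2C_AΛ⁻¹∫_{σ⋆}^{σ}‖W_{k+2}‖)·G(σ⋆)`, because the only way out that is not counted in `G`
is the bond above, `F_{k+1} ≤ 2C_AΛ⁻¹‖W_{k+2}‖E_{k+1} ≤ 2C_AΛ⁻¹‖W_{k+2}‖G_{k+1}`).  Hence, for sign-coherent bond fluxes
(`0 ≤ F_j` everywhere — energy only moves UP the ladder or is dissipated):

* `throughput_succ_le_visc` — **`Φ_{k+1} ≤ (1 − e^{−κ}/(1+κ))·Φ_k`**, `Φ_j = ∫_ℝ F_j`, `κ = 2C_AΛ⁻¹·a`, `a ≥ ∫‖W_{k+2}‖`, for EVERY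
  covariant viscosity `ν̂ ≥ 0` (dissipation only enlarges the permanent loss `wake + dissipated ≥ e^{−κ}·sup G_{k+1}`);
* `throughput_le_pow_visc` — with a uniform action budget `M`: `Φ_{k₀+n} ≤ ρⁿ Φ_{k₀}`, `ρ = 1 − e^{−κ}/(1+κ)`, `κ = 2C_AΛ⁻¹M`;
* `physEnergy_le_throughput_visc` — `E_{k+1} ≤ Φ_k` at all log-times.

The survival consequences for the crux's own predicate `NoSurvivingEternalViscBdd R 1` (logarithmic action floor, slice by name,
(ρ0) and (ρ+) readings) are in `…UpwardFluxRung`.  HONEST LABEL: a rung; (ρ0), (ρ+), ⟨20419⟩ and every NS statement remain OPEN.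
-/

noncomputable section

-- the summit and its single sub-problem share the name (CONVENTIONS §1)
set_option linter.dupNamespace false

namespace Summit.NavierStokesRegularity.NavierStokesRegularity.Theorems.NoSurvivingEternalViscBddOne.UpwardFlux

open Set Filter Topology MeasureTheory
open scoped RealInnerProductSpace
open Literature.Analysis.FluidPDE Literature.Analysis.FluidPDE.TaoCascade
open Summit.NavierStokesRegularity.NavierStokesRegularity.Theorems.NoSurvivingEternalViscBddOne.SmallAction
  (continuous_physEnergy continuous_physFlux tendsto_physEnergy_atBot exists_physEnergy_le viscCoef_nonneg)

variable {m : ℕ} {ε₀ νh : ℝ} {α : Fin m → Fin m → Fin m → ℤ × ℤ × ℤ → ℝ} {W : ℤ → ℝ → Em m}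

/-! ## The held energy `G_{k+1} = ∫_{-∞}^{σ}F_k − ∫_{-∞}^{σ}F_{k+1}` -/

/-- **The shell energy is dominated by the held energy** (any `ν̂ ≥ 0`): `E_{k+1}(σ) ≤ ∫_{-∞}^{σ}F_k − ∫_{-∞}^{σ}F_{k+1}` — the
difference is the energy dissipated in shell `k+1` up to log-time `σ` (`≥ 0`).
[cite: Tao2016AveragedNS, §4 Lemma 4.1 (4.8)–(4.10) with (4.3) and the viscous equation before Thm. 4.2, §6.4; tree `hasDerivAt_physEnergy`] -/
theorem physEnergy_le_heldEnergy (hε : 0 < ε₀) (hW : IsEternalVisc ε₀ νh α W) (hc : IsCancellingCoeff α)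
    (hU : UniformBound W) (k : ℤ) (σ : ℝ) :
    physEnergy ε₀ W (k + 1) σ
      ≤ (∫ s in Iic σ, physFlux ε₀ α W k s) - ∫ s in Iic σ, physFlux ε₀ α W (k + 1) s := by
  have hFk := integrable_physFlux hε hW hc hU k
  have hFk1 := integrable_physFlux hε hW hc hU (k + 1)
  have cFk := continuous_physFlux hW hc k
  have cFk1 := continuous_physFlux hW hc (k + 1)
  have cE : Continuous (physEnergy ε₀ W (k + 1)) := continuous_physEnergy hW (k + 1)
  have cvisc : Continuous fun s => viscCoef ε₀ νh (k + 1) s := by unfold viscCoef; fun_prop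
  -- the derivative of `E_{k+1}`
  set D : ℝ → ℝ := fun s => physFlux ε₀ α W k s - physFlux ε₀ α W (k + 1) s
      - 2 * viscCoef ε₀ νh (k + 1) s * physEnergy ε₀ W (k + 1) s with hD
  have hderiv : ∀ s, HasDerivAt (physEnergy ε₀ W (k + 1)) (D s) s := by
    intro s
    have h := hasDerivAt_physEnergy hε hW hc (k + 1) s
    rw [add_sub_cancel_right] at h
    exact h
  have cD : Continuous D := by simp only [hD]; fun_prop
  have hDle : ∀ s, D s ≤ physFlux ε₀ α W k s - physFlux ε₀ α W (k + 1) s := by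
    intro s
    have := mul_nonneg (mul_nonneg two_pos.le (viscCoef_nonneg hε hW.nonneg (k + 1) s))
      (physEnergy_nonneg ε₀ W (k + 1) s)
    simp only [hD]; linarith
  -- FTC on `[a, σ]` and comparison
  have hftc : ∀ a, a ≤ σ → physEnergy ε₀ W (k + 1) σ - physEnergy ε₀ W (k + 1) a
      ≤ (∫ s in a..σ, physFlux ε₀ α W k s) - ∫ s in a..σ, physFlux ε₀ α W (k + 1) s := by
    intro a ha
    rw [← intervalIntegral.integral_eq_sub_of_hasDerivAt (fun s _ => hderiv s) (cD.intervalIntegrable _ _),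
      ← intervalIntegral.integral_sub (cFk.intervalIntegrable _ _) (cFk1.intervalIntegrable _ _)]
    exact intervalIntegral.integral_mono_on ha (cD.intervalIntegrable _ _)
      ((cFk.sub cFk1).intervalIntegrable _ _) fun s _ => hDle s
  -- send `a → -∞`
  have hlim1 : Tendsto (fun a : ℝ => physEnergy ε₀ W (k + 1) σ - physEnergy ε₀ W (k + 1) a) atBot
      (𝓝 (physEnergy ε₀ W (k + 1) σ - 0)) :=
    tendsto_const_nhds.sub (tendsto_physEnergy_atBot hε hU (k + 1))
  have hlim2 : Tendsto (fun a : ℝ => (∫ s in a..σ, physFlux ε₀ α W k s) - ∫ s in a..σ, physFlux ε₀ α W (k + 1) s)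
      atBot (𝓝 ((∫ s in Iic σ, physFlux ε₀ α W k s) - ∫ s in Iic σ, physFlux ε₀ α W (k + 1) s)) :=
    (intervalIntegral_tendsto_integral_Iic σ hFk.integrableOn tendsto_id).sub
      (intervalIntegral_tendsto_integral_Iic σ hFk1.integrableOn tendsto_id)
  have hev : ∀ᶠ a in atBot, physEnergy ε₀ W (k + 1) σ - physEnergy ε₀ W (k + 1) a
      ≤ (∫ s in a..σ, physFlux ε₀ α W k s) - ∫ s in a..σ, physFlux ε₀ α W (k + 1) s := by
    filter_upwards [eventually_le_atBot σ] with a ha using hftc a ha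
  have := le_of_tendsto_of_tendsto hlim1 hlim2 hev
  rwa [sub_zero] at this

/-- The cumulative throughput `u ↦ ∫_{-∞}^{u}F` of a continuous integrable flux has derivative `F`. [folklore] -/
theorem hasDerivAt_integral_Iic {F : ℝ → ℝ} (hF : Integrable F) (hcF : Continuous F) (σ u : ℝ) :
    HasDerivAt (fun v => ∫ s in Iic v, F s) (F u) u := by
  have heq : (fun v => ∫ s in Iic v, F s) = fun v => (∫ s in σ..v, F s) + ∫ s in Iic σ, F s := by
    funext v
    have := intervalIntegral.integral_Iic_sub_Iic (μ := volume) (f := F) (a := σ) (b := v)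
      hF.integrableOn hF.integrableOn
    linarith
  rw [heq]
  exact ((hcF.integral_hasStrictDerivAt σ u).hasDerivAt).add_const _

/-- **No-backscatter retention of the held energy** (any `ν̂ ≥ 0`).  If the incoming flux `F_k` is non-negative on `[σ⋆, σ]`, then
`exp(−Θ)·G_{k+1}(σ⋆) ≤ G_{k+1}(σ)` for any `Θ ≥ ∫_{σ⋆}^{σ}2C_AΛ⁻¹‖W_{k+2}‖`: the held energy can only decrease through the bond above,
at relative rate at most `2C_AΛ⁻¹‖W_{k+2}‖` (`F_{k+1} ≤ 2C_AΛ⁻¹‖W_{k+2}‖E_{k+1} ≤ 2C_AΛ⁻¹‖W_{k+2}‖G_{k+1}`).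
[cite: Tao2016AveragedNS, §4 Lemma 4.1 (4.8)–(4.10) with (4.3) and the viscous equation before Thm. 4.2, §6.4; this file] -/
theorem heldEnergy_ge_retention (hε : 0 < ε₀) (hW : IsEternalVisc ε₀ νh α W) (hc : IsCancellingCoeff α)
    (hU : UniformBound W) (k : ℤ) {σs σ : ℝ} (hle : σs ≤ σ) (hF : ∀ s ∈ Icc σs σ, 0 ≤ physFlux ε₀ α W k s)
    {Θ : ℝ} (hΘ : ∫ s in σs..σ, 2 * fluxConst α * (bigLam ε₀)⁻¹ * ‖W (k + 2) s‖ ≤ Θ) :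
    Real.exp (-Θ) * ((∫ s in Iic σs, physFlux ε₀ α W k s) - ∫ s in Iic σs, physFlux ε₀ α W (k + 1) s)
      ≤ (∫ s in Iic σ, physFlux ε₀ α W k s) - ∫ s in Iic σ, physFlux ε₀ α W (k + 1) s := by
  set κ₀ := 2 * fluxConst α * (bigLam ε₀)⁻¹ with hκ₀
  have hΛ : 0 < bigLam ε₀ := bigLam_pos (by linarith)
  have hκ₀nn : 0 ≤ κ₀ := by have := fluxConst_nonneg α; positivity
  have hFk := integrable_physFlux hε hW hc hU k
  have hFk1 := integrable_physFlux hε hW hc hU (k + 1)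
  have cFk := continuous_physFlux hW hc k
  have cFk1 := continuous_physFlux hW hc (k + 1)
  have cWk2 : Continuous (W (k + 2)) := continuous_iff_continuousAt.2 fun s => (hW.law (k + 2) s).continuousAt
  -- the held energy `G` and its derivative `F_k − F_{k+1}`
  set G : ℝ → ℝ := fun u => (∫ s in Iic u, physFlux ε₀ α W k s) - ∫ s in Iic u, physFlux ε₀ α W (k + 1) s with hG
  have hGderiv : ∀ u, HasDerivAt G (physFlux ε₀ α W k u - physFlux ε₀ α W (k + 1) u) u := fun u =>
    (hasDerivAt_integral_Iic hFk cFk σs u).sub (hasDerivAt_integral_Iic hFk1 cFk1 σs u)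
  have cG : Continuous G := continuous_iff_continuousAt.2 fun u => (hGderiv u).continuousAt
  have hEG : ∀ u, physEnergy ε₀ W (k + 1) u ≤ G u := fun u => physEnergy_le_heldEnergy hε hW hc hU k u
  have hGnn : ∀ u, 0 ≤ G u := fun u => (physEnergy_nonneg ε₀ W (k + 1) u).trans (hEG u)
  -- the rate `θ ≥ 0` and its primitive `P`
  set θ : ℝ → ℝ := fun s => κ₀ * ‖W (k + 2) s‖ with hθ
  have cθ : Continuous θ := by simp only [hθ]; fun_prop
  have hθnn : ∀ s, 0 ≤ θ s := fun s => mul_nonneg hκ₀nn (norm_nonneg _)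
  set P : ℝ → ℝ := fun u => ∫ x in σs..u, θ x with hP
  have hPderiv : ∀ u, HasDerivAt P (θ u) u := fun u => (cθ.integral_hasStrictDerivAt σs u).hasDerivAt
  have cP : Continuous P := continuous_iff_continuousAt.2 fun u => (hPderiv u).continuousAt
  have hP0 : P σs = 0 := by simp [hP]
  have hPσ : P σ ≤ Θ := hΘ
  -- `Ψ = e^{P} G` is non-decreasing on `[σ⋆, σ]`
  set Ψ : ℝ → ℝ := fun s => Real.exp (P s) * G s with hΨ
  set Ψ' : ℝ → ℝ := fun s => Real.exp (P s) * θ s * G s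
      + Real.exp (P s) * (physFlux ε₀ α W k s - physFlux ε₀ α W (k + 1) s) with hΨ'
  have hΨderiv : ∀ s, HasDerivAt Ψ (Ψ' s) s := by
    intro s
    have h1 : HasDerivAt (fun u => Real.exp (P u)) (Real.exp (P s) * θ s) s := (hPderiv s).exp
    exact h1.mul (hGderiv s)
  have cΨ' : Continuous Ψ' := by
    have : Continuous fun s => Real.exp (P s) := cP.rexp
    simp only [hΨ']; fun_prop
  have hpos : ∀ s ∈ Icc σs σ, 0 ≤ Ψ' s := by
    intro s hs
    have heP : 0 < Real.exp (P s) := Real.exp_pos _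
    have hFk1le : physFlux ε₀ α W (k + 1) s ≤ κ₀ * ‖W (k + 2) s‖ * physEnergy ε₀ W (k + 1) s := by
      have := (le_abs_self _).trans (abs_physFlux_le hε hc W (k + 1) s)
      rw [show k + 1 + 1 = k + 2 by ring] at this; rw [hκ₀]; linarith
    have hFk1G : physFlux ε₀ α W (k + 1) s ≤ θ s * G s :=
      hFk1le.trans (mul_le_mul_of_nonneg_left (hEG s) (hθnn s))
    have hsum : 0 ≤ θ s * G s + (physFlux ε₀ α W k s - physFlux ε₀ α W (k + 1) s) := by
      linarith [hF s hs]
    have : Ψ' s = Real.exp (P s) * (θ s * G s + (physFlux ε₀ α W k s - physFlux ε₀ α W (k + 1) s)) := by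
      simp only [hΨ']; ring
    rw [this]
    exact mul_nonneg heP.le hsum
  -- integrate over `[σ⋆, σ]`
  have hftc : ∫ s in σs..σ, Ψ' s = Ψ σ - Ψ σs :=
    intervalIntegral.integral_eq_sub_of_hasDerivAt (fun s _ => hΨderiv s) (cΨ'.intervalIntegrable _ _)
  have hint0 : 0 ≤ ∫ s in σs..σ, Ψ' s := intervalIntegral.integral_nonneg hle fun s hs => hpos s hs
  have hΨs : Ψ σs = G σs := by simp [hΨ, hP0]
  have hΨσ : Ψ σ = Real.exp (P σ) * G σ := rfl
  have hkey : G σs ≤ Real.exp (P σ) * G σ := by rw [← hΨσ, ← hΨs]; linarith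
  have e1 : Real.exp (-P σ) * Real.exp (P σ) = 1 := by rw [← Real.exp_add, neg_add_cancel, Real.exp_zero]
  have h2 : Real.exp (-P σ) * G σs ≤ G σ := by
    have h := mul_le_mul_of_nonneg_left hkey (Real.exp_pos (-P σ)).le
    rwa [← mul_assoc, e1, one_mul] at h
  have hexp : Real.exp (-Θ) ≤ Real.exp (-P σ) := Real.exp_le_exp.2 (by linarith)
  show Real.exp (-Θ) * G σs ≤ G σ
  calc Real.exp (-Θ) * G σs ≤ Real.exp (-P σ) * G σs := mul_le_mul_of_nonneg_right hexp (hGnn σs)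
    _ ≤ G σ := h2

/-! ## The throughput recursion with covariant viscosity -/

/-- **THE THROUGHPUT RECURSION, any `ν̂ ≥ 0`** (all bond fluxes non-negative).  With `Φ_j = ∫_ℝ F_j` and `κ = 2C_AΛ⁻¹·a`,
`a ≥ ∫‖W_{k+2}‖`:  `Φ_{k+1} ≤ (1 − e^{−κ}/(1+κ))·Φ_k` — shell `k+1` keeps or dissipates at least the fraction `e^{−κ}/(1+κ)` of
everything that reaches it.
[cite: Tao2016AveragedNS, §4 Lemma 4.1 (4.8)–(4.10) with (4.3) and the viscous equation before Thm. 4.2, §6.4; this file] -/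
theorem throughput_succ_le_visc (hε : 0 < ε₀) (hW : IsEternalVisc ε₀ νh α W) (hc : IsCancellingCoeff α)
    (hU : UniformBound W) (hF : ∀ (j : ℤ) (s : ℝ), 0 ≤ physFlux ε₀ α W j s) (k : ℤ) {a : ℝ}
    (ha : ∫ s, ‖W (k + 2) s‖ ≤ a) :
    (∫ s, physFlux ε₀ α W (k + 1) s)
      ≤ (1 - Real.exp (-(2 * fluxConst α * (bigLam ε₀)⁻¹ * a)) / (1 + 2 * fluxConst α * (bigLam ε₀)⁻¹ * a))
        * ∫ s, physFlux ε₀ α W k s := by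
  set κ₀ := 2 * fluxConst α * (bigLam ε₀)⁻¹ with hκ₀
  have hΛ : 0 < bigLam ε₀ := bigLam_pos (by linarith)
  have hκ₀nn : 0 ≤ κ₀ := by have := fluxConst_nonneg α; positivity
  obtain ⟨Mact, hMact⟩ := hW.action
  have hint2 : Integrable (fun s => ‖W (k + 2) s‖) := (hMact (k + 2)).1
  have ha0 : 0 ≤ a := le_trans (integral_nonneg fun s => norm_nonneg _) ha
  set κ := κ₀ * a with hκdef
  have hκnn : 0 ≤ κ := mul_nonneg hκ₀nn ha0
  have h1κ : 0 < 1 + κ := by linarith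
  have hFk := integrable_physFlux hε hW hc hU k
  have hFk1 := integrable_physFlux hε hW hc hU (k + 1)
  set x := ∫ s, physFlux ε₀ α W k s with hx
  set y := ∫ s, physFlux ε₀ α W (k + 1) s with hy
  -- the held energy and its properties
  set G : ℝ → ℝ := fun u => (∫ s in Iic u, physFlux ε₀ α W k s) - ∫ s in Iic u, physFlux ε₀ α W (k + 1) s with hG
  have hEG : ∀ u, physEnergy ε₀ W (k + 1) u ≤ G u := fun u => physEnergy_le_heldEnergy hε hW hc hU k u
  have hGnn : ∀ u, 0 ≤ G u := fun u => (physEnergy_nonneg ε₀ W (k + 1) u).trans (hEG u)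
  have hIk : ∀ σ, (∫ s in Iic σ, physFlux ε₀ α W k s) ≤ x := fun σ =>
    integral_Iic_le_integral_of_nonneg hFk (hF k) σ
  have hIk1 : ∀ σ, (∫ s in Iic σ, physFlux ε₀ α W (k + 1) s) = (∫ s in Iic σ, physFlux ε₀ α W k s) - G σ := by
    intro σ; simp only [hG]; ring
  -- retention with the whole action of shell `k+2`
  have hret : ∀ σs σ, σs ≤ σ → Real.exp (-κ) * G σs ≤ G σ := by
    intro σs σ hle
    refine heldEnergy_ge_retention hε hW hc hU k hle (fun s _ => hF k s) ?_
    rw [intervalIntegral.integral_const_mul]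
    refine mul_le_mul_of_nonneg_left ?_ hκ₀nn
    rw [intervalIntegral.integral_of_le hle]
    exact (setIntegral_le_integral hint2 (Eventually.of_forall fun s => norm_nonneg _)).trans ha
  have hexp1 : Real.exp (-κ) ≤ 1 := Real.exp_le_one_iff.2 (by linarith)
  -- Step A: `y ≤ x − e^{-κ} G(σ⋆)` for every `σ⋆`
  have hA : ∀ σs, y ≤ x - Real.exp (-κ) * G σs := by
    intro σs
    refine integral_le_of_integral_Iic_le hFk1 (hF (k + 1)) fun σ => ?_
    rcases le_total σs σ with hle | hle
    · rw [hIk1 σ]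
      linarith [hIk σ, hret σs σ hle]
    · have hmono := integral_Iic_mono_of_nonneg hFk1 (hF (k + 1)) hle
      have h3 : Real.exp (-κ) * G σs ≤ G σs := by
        have := mul_le_mul_of_nonneg_right hexp1 (hGnn σs); rwa [one_mul] at this
      rw [hIk1 σs] at hmono
      linarith [hIk σs]
  -- Step B: `E ≤ G ≤ e^{κ}(x − y)`
  have hexpκ : 0 < Real.exp κ := Real.exp_pos κ
  have eκ : Real.exp κ * Real.exp (-κ) = 1 := by rw [← Real.exp_add, add_neg_cancel, Real.exp_zero]
  have hB : ∀ σ, G σ ≤ Real.exp κ * (x - y) := by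
    intro σ
    have h := mul_le_mul_of_nonneg_left (show Real.exp (-κ) * G σ ≤ x - y by linarith [hA σ]) hexpκ.le
    rwa [← mul_assoc, eκ, one_mul] at h
  -- Step C: `x ≤ e^{κ}(x − y) + y`
  have hC : x ≤ Real.exp κ * (x - y) + y := by
    refine integral_le_of_integral_Iic_le hFk (hF k) fun σ => ?_
    have h1 : (∫ s in Iic σ, physFlux ε₀ α W k s) = G σ + ∫ s in Iic σ, physFlux ε₀ α W (k + 1) s := by
      rw [hIk1 σ]; ring
    rw [h1]
    linarith [hB σ, integral_Iic_le_integral_of_nonneg hFk1 (hF (k + 1)) σ]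
  -- Step D: `y ≤ κ e^{κ}(x − y)`
  have hD : y ≤ κ * (Real.exp κ * (x - y)) := by
    have hpt : ∀ s, physFlux ε₀ α W (k + 1) s ≤ κ₀ * (Real.exp κ * (x - y)) * ‖W (k + 2) s‖ := by
      intro s
      have h := (le_abs_self _).trans (abs_physFlux_le hε hc W (k + 1) s)
      rw [show k + 1 + 1 = k + 2 by ring] at h
      calc physFlux ε₀ α W (k + 1) s ≤ 2 * fluxConst α * (bigLam ε₀)⁻¹ * ‖W (k + 2) s‖ * physEnergy ε₀ W (k + 1) s := h
        _ ≤ 2 * fluxConst α * (bigLam ε₀)⁻¹ * ‖W (k + 2) s‖ * (Real.exp κ * (x - y)) :=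
            mul_le_mul_of_nonneg_left ((hEG s).trans (hB s)) (mul_nonneg hκ₀nn (norm_nonneg _))
        _ = κ₀ * (Real.exp κ * (x - y)) * ‖W (k + 2) s‖ := by rw [hκ₀]; ring
    have hP'nn : 0 ≤ Real.exp κ * (x - y) := (hGnn 0).trans (hB 0)
    calc y ≤ ∫ s, κ₀ * (Real.exp κ * (x - y)) * ‖W (k + 2) s‖ := integral_mono hFk1 (hint2.const_mul _) hpt
      _ = κ₀ * (Real.exp κ * (x - y)) * ∫ s, ‖W (k + 2) s‖ := integral_const_mul _ _
      _ ≤ κ₀ * (Real.exp κ * (x - y)) * a := mul_le_mul_of_nonneg_left ha (mul_nonneg hκ₀nn hP'nn)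
      _ = κ * (Real.exp κ * (x - y)) := by rw [hκdef]; ring
  -- combine
  have h1 : x ≤ (1 + κ) * (Real.exp κ * (x - y)) := by linarith
  have h2 : Real.exp (-κ) * x ≤ (1 + κ) * (x - y) := by
    have h := mul_le_mul_of_nonneg_left h1 (Real.exp_pos (-κ)).le
    calc Real.exp (-κ) * x ≤ Real.exp (-κ) * ((1 + κ) * (Real.exp κ * (x - y))) := h
      _ = (1 + κ) * (x - y) * (Real.exp κ * Real.exp (-κ)) := by ring
      _ = (1 + κ) * (x - y) := by rw [eκ, mul_one]
  have h3 : Real.exp (-κ) / (1 + κ) * x ≤ x - y := by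
    rw [div_mul_eq_mul_div, div_le_iff₀ h1κ]; linarith
  show y ≤ (1 - Real.exp (-κ) / (1 + κ)) * x
  linarith

/-- **The throughput chain, any `ν̂ ≥ 0`**: with a uniform action budget `∫‖W_n‖ ≤ M`, `ρ = 1 − e^{−κ}/(1+κ)`, `κ = 2C_AΛ⁻¹M`:
`Φ_{k₀+n} ≤ ρⁿ·Φ_{k₀}` for every `n ∈ ℕ`.
[cite: Tao2016AveragedNS, §4 Lemma 4.1 (4.8)–(4.10), §6.4; this file] -/
theorem throughput_le_pow_visc (hε : 0 < ε₀) (hW : IsEternalVisc ε₀ νh α W) (hc : IsCancellingCoeff α)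
    (hU : UniformBound W) (hF : ∀ (j : ℤ) (s : ℝ), 0 ≤ physFlux ε₀ α W j s) {M : ℝ} (hM : ∀ n, ∫ s, ‖W n s‖ ≤ M)
    (k₀ : ℤ) :
    ∀ n : ℕ, (∫ s, physFlux ε₀ α W (k₀ + n) s)
      ≤ (1 - Real.exp (-(2 * fluxConst α * (bigLam ε₀)⁻¹ * M)) / (1 + 2 * fluxConst α * (bigLam ε₀)⁻¹ * M)) ^ n
        * ∫ s, physFlux ε₀ α W k₀ s := by
  set ρ := 1 - Real.exp (-(2 * fluxConst α * (bigLam ε₀)⁻¹ * M)) / (1 + 2 * fluxConst α * (bigLam ε₀)⁻¹ * M)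
    with hρ
  have hM0 : 0 ≤ M := le_trans (integral_nonneg fun s => norm_nonneg (W 0 s)) (hM 0)
  have hκnn : 0 ≤ 2 * fluxConst α * (bigLam ε₀)⁻¹ * M := by
    have := fluxConst_nonneg α; have := (bigLam_pos (by linarith : (-1 : ℝ) < ε₀)).le; positivity
  have hρ0 : 0 ≤ ρ := (ratio_bounds hκnn).1
  intro n
  induction n with
  | zero => simp
  | succ n ih =>
    have hstep := throughput_succ_le_visc hε hW hc hU hF (k₀ + n) (hM (k₀ + n + 2))
    have e1 : k₀ + ((n + 1 : ℕ) : ℤ) = k₀ + n + 1 := by push_cast; ring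
    rw [e1, pow_succ]
    calc (∫ s, physFlux ε₀ α W (k₀ + ↑n + 1) s) ≤ ρ * ∫ s, physFlux ε₀ α W (k₀ + ↑n) s := hstep
      _ ≤ ρ * (ρ ^ n * ∫ s, physFlux ε₀ α W k₀ s) := mul_le_mul_of_nonneg_left ih hρ0
      _ = ρ ^ n * ρ * ∫ s, physFlux ε₀ α W k₀ s := by ring

/-- **Shell energies are bounded by the throughput of the bond below**, any `ν̂ ≥ 0`: `E_{k+1}(σ) ≤ Φ_k` (all fluxes non-negative).
[cite: Tao2016AveragedNS, §4 Lemma 4.1 (4.8)–(4.10), §6.4; this file] -/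
theorem physEnergy_le_throughput_visc (hε : 0 < ε₀) (hW : IsEternalVisc ε₀ νh α W) (hc : IsCancellingCoeff α)
    (hU : UniformBound W) (hF : ∀ (j : ℤ) (s : ℝ), 0 ≤ physFlux ε₀ α W j s) (k : ℤ) (σ : ℝ) :
    physEnergy ε₀ W (k + 1) σ ≤ ∫ s, physFlux ε₀ α W k s := by
  have hFk := integrable_physFlux hε hW hc hU k
  have h0 := physEnergy_le_heldEnergy hε hW hc hU k σ
  have h1 := integral_Iic_le_integral_of_nonneg hFk (hF k) σ
  have h2 : 0 ≤ ∫ s in Iic σ, physFlux ε₀ α W (k + 1) s := integral_nonneg fun s => hF (k + 1) s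
  linarith

end Summit.NavierStokesRegularity.NavierStokesRegularity.Theorems.NoSurvivingEternalViscBddOne.UpwardFlux

end
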